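import Literature.Computability.AlgebraicComplexity.GMQ16PDefinableDegenerations
import Literature.Computability.AlgebraicComplexity.IMMInVPProofs
import Literature.Computability.AlgebraicComplexity.SkewCircuitAffineSubstitution
import Literature.Computability.AlgebraicComplexity.BLMW11WeaklySkewToSkewProofs
import HarnessLib

/-!
# Grochow–Mulmuley–Qiao 2016, Prop. 3.5 BY NAME: `prop_3_5_holds` (`VP* ⊆ \overline{VP}`),
# and its weakly-skew analogue `VP_ws* ⊆ \overline{VP_ws}`

Theorem-only file (no definitions, no named facts; census −1: the x-row fact `GMQ2016.prop_3_5` of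
`GMQ16PDefinableDegenerations.lean` is DISCHARGED BY NAME). Source: J. A. Grochow, K. D. Mulmuley,
Y. Qiao, *Boundaries of VP and VNP*, ICALP 2016, arXiv:1605.02815 [GrochowMulmuleyQiao2016],
Prop. 3.5 (p. 10: "VP* ⊆ \overline{VP}, immediate from the definitions"). In the source `\overline{VP}`
is defined operationally through Laurent/power-series approximations; the tree's `IsVPBarFamily` is
the Zariski-closure rendering of BLMW 2011 Def. 9.3.1 (`approxComplexity`), so "immediate" becomes
the classical one-parameter-family argument written out below.

## What is proved

* `GMQ2016.approxComplexity_le_of_isLimit` — if `f = lim_{t→0} g(y₁(t),…,y_l(t))` for affine forms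
  `yᵢ` in `m` variables with Laurent-polynomial coefficients (`GMQ2016.IsLimit f (degenerate g a)`),
  then `\underline{L}(f) ≤ L(g) + l(2m+1)`; `GMQ2016.approxWsComplexity_le_of_isLimit` — the same
  with `\underline{L_ws}(f) ≤ (4 L_ws(g) + l)(2m+3)`.
* `GMQ2016.prop_3_5_holds : prop_3_5` (`VP* ⊆ \overline{VP}`) and
  `GMQ2016.isVPwsBarFamily_of_isVPwsStarFamily` (`VP_ws* ⊆ \overline{VP_ws}`); p-definability of
  the degeneration is not used (only `IsLimit`), exactly as in the source.

## Proof (the one-parameter-family argument)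

Fix a polynomial `P` on coefficient space vanishing on `{h | L(h) ≤ L(g) + l(2m+1)}`. For every unit
`u ∈ Fˣ` the evaluation `t ↦ u` (`LaurentPolynomial.eval₂`) maps `G = g(y(t))` to
`h_u = g(y(u)) = aeval (affine forms with scalar coefficients) g`, whose complexity is at most
`L(g) + l(2m+1)` (`complexity_aeval_le` + the cost `2m+1` of an affine form), so `P(coeffVec h_u) = 0`.
Since the coefficients of `G` have no pole at `t = 0` (`IsLimit`), they lift to honest polynomials
`p_μ ∈ F[t]` (`toLaurent p_μ = coeff μ G`: clear denominators with `LaurentPolynomial.exists_T_pow`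
and divide by `X^n` using `Polynomial.X_pow_dvd_iff`); then `R := P(p_μ)_μ ∈ F[t]` has `R(u) =
P(coeffVec h_u) = 0` for every `u ≠ 0`, hence `R = 0` (`F = ℂ` is infinite,
`Polynomial.eq_zero_of_infinite_isRoot`), and `R(0) = P((p_μ(0))_μ) = P(coeffVec f)` because
`p_μ(0) = (coeff μ G)(t⁰) = coeff μ f`. The weakly-skew version replaces the complexity estimate by
`wsComplexity_aeval_affine_le` (BLMW 2011 Prop. 9.3.2, proof) and `L_skew ≤ 4 L_ws`
(`skewComplexity_le_four_mul_wsComplexity`).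
-/

namespace Literature.Computability.AlgebraicComplexity.GMQ2016

open MvPolynomial LaurentPolynomial Polynomial

/-! ### Laurent-polynomial bookkeeping -/

section Laurent

variable {F : Type*} [CommRing F]

/-- Coefficients of `C r · T^n`. [folklore] -/
private theorem coeff_C_mul_T (r : F) (n a : ℤ) :
    (LaurentPolynomial.C r * T n).coeff a = if a = n then r else 0 := by
  rw [← single_eq_C_mul_T, AddMonoidAlgebra.coeff_single, Finsupp.single_apply]; simp [eq_comm]

/-- Coefficients of `toLaurent p`. [folklore] -/
private theorem coeff_toLaurent_ite (p : F[X]) (a : ℤ) :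
    (toLaurent p).coeff a = if 0 ≤ a then p.coeff a.toNat else 0 := by
  induction p using Polynomial.induction_on' with
  | add p q hp hq =>
    simp only [map_add, AddMonoidAlgebra.coeff_add, Finsupp.add_apply, hp, hq, Polynomial.coeff_add]
    split_ifs <;> simp
  | monomial n r =>
    rw [Polynomial.toLaurent_C_mul_T, coeff_C_mul_T, Polynomial.coeff_monomial]
    by_cases h : 0 ≤ a
    · rw [if_pos h]
      by_cases h' : a = n
      · subst h'; simp
      · rw [if_neg h', if_neg (by omega)]
    · rw [if_neg h, if_neg (by omega)]

/-- Coefficients of `q · T^n`. [folklore] -/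
private theorem coeff_mul_T (q : F[T;T⁻¹]) (n a : ℤ) : (q * T n).coeff a = q.coeff (a - n) := by
  rw [T, AddMonoidAlgebra.coeff_mul_single_eq_coeff_mul (a - n)
    (fun m _ => by constructor <;> intro h <;> omega), mul_one]

/-- A Laurent polynomial without negative powers is a polynomial. [folklore] -/
private theorem exists_toLaurent_eq_of_coeff_neg (q : F[T;T⁻¹])
    (h : ∀ z : ℤ, z < 0 → q.coeff z = 0) : ∃ p : F[X], toLaurent p = q := by
  obtain ⟨n, p', hp'⟩ := exists_T_pow q
  have hdvd : (X : F[X]) ^ n ∣ p' := by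
    refine Polynomial.X_pow_dvd_iff.mpr fun d hd => ?_
    have := congrArg (fun x : F[T;T⁻¹] => x.coeff (d : ℤ)) hp'
    simp only [coeff_toLaurent_ite, coeff_mul_T] at this
    rw [if_pos (by omega), h _ (by omega)] at this
    simpa using this
  obtain ⟨p, rfl⟩ := hdvd
  refine ⟨p, ?_⟩
  have h2 : toLaurent p * T n = q * T n := by
    rw [← hp', map_mul, Polynomial.toLaurent_X_pow, mul_comm]
  exact (isUnit_T n).mul_left_injective h2

/-- The constant Laurent coefficient of `toLaurent p` is `p(0)`. [folklore] -/
private theorem coeff_toLaurent_zero (p : F[X]) : (toLaurent p).coeff 0 = p.eval 0 := by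
  rw [coeff_toLaurent_ite, if_pos le_rfl, ← Polynomial.coeff_zero_eq_eval_zero]; rfl

/-- Evaluating the parameter at a unit commutes with the substitution: `(g(y(t)))|_{t=u} =
g(y(u))`. [folklore] -/
private theorem map_degenerate_eq {l m : ℕ} (φ : F[T;T⁻¹] →+* F)
    (hφ : ∀ r : F, φ (LaurentPolynomial.C r) = r) (g : MvPolynomial (Fin l) F)
    (a : Fin l → Option (Fin m) → F[T;T⁻¹]) :
    MvPolynomial.map φ (degenerate g a) =
      aeval (fun i => MvPolynomial.C (φ (a i none)) +
        ∑ j : Fin m, MvPolynomial.C (φ (a i (some j))) * X j) g := by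
  unfold degenerate
  induction g using MvPolynomial.induction_on with
  | C c =>
    simp [MvPolynomial.algebraMap_apply, LaurentPolynomial.algebraMap_apply, MvPolynomial.map_C, hφ]
  | add p q hp hq => simp [hp, hq]
  | mul_X p i hp => simp [hp, substForm, MvPolynomial.map_C, map_sum]

end Laurent

/-! ### Complexity of an affine substitution with scalar coefficients -/

section Affine

variable {F : Type*} [CommRing F]

/-- An affine form costs at most `2m + 1` gates. [folklore] -/
private theorem complexity_affine_le {m : ℕ} (c : F) (b : Fin m → F) :
    complexity (MvPolynomial.C c + ∑ j : Fin m, MvPolynomial.C (b j) * X j : MvPolynomial (Fin m) F)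
      ≤ 2 * m + 1 := by
  refine (complexity_add_le_holds _ _).trans ?_
  rw [complexity_C_holds (k := F) c, zero_add]
  have h := complexity_finset_sum_le (Finset.univ : Finset (Fin m))
    (fun j => (MvPolynomial.C (b j) * X j : MvPolynomial (Fin m) F))
  have h2 : ∑ j : Fin m, complexity (MvPolynomial.C (b j) * X j : MvPolynomial (Fin m) F)
      ≤ ∑ _j : Fin m, 1 := by
    refine Finset.sum_le_sum fun j _ => (complexity_mul_le_holds _ _).trans ?_
    rw [complexity_C_holds (k := F), complexity_X_holds (k := F)]
  rw [Finset.sum_const, Finset.card_univ, Fintype.card_fin, smul_eq_mul, mul_one] at h2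
  rw [Finset.card_univ, Fintype.card_fin] at h
  omega

/-- `L(g(y)) ≤ L(g) + l(2m+1)` for affine forms `y` with scalar coefficients. [folklore] -/
private theorem complexity_aeval_affine_le {l m : ℕ} (g : MvPolynomial (Fin l) F)
    (c : Fin l → F) (b : Fin l → Fin m → F) :
    complexity (aeval (fun i => MvPolynomial.C (c i) +
        ∑ j : Fin m, MvPolynomial.C (b i j) * X j) g) ≤ complexity g + l * (2 * m + 1) := by
  refine (complexity_aeval_le _ _).trans ?_
  have : ∑ i : Fin l, complexity (MvPolynomial.C (c i) +
      ∑ j : Fin m, MvPolynomial.C (b i j) * X j : MvPolynomial (Fin m) F) ≤ ∑ _i : Fin l, (2 * m + 1) :=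
    Finset.sum_le_sum fun i _ => complexity_affine_le _ _
  rw [Finset.sum_const, Finset.card_univ, Fintype.card_fin, smul_eq_mul] at this
  omega

/-- The scalar affine forms are BLMW's `ψ` (`SkewSubst.psi`). [folklore] -/
private theorem affine_eq_psi {l m : ℕ} (c : Fin l → F) (b : Fin l → Fin m → F) :
    (fun i => MvPolynomial.C (c i) + ∑ j : Fin m, MvPolynomial.C (b i j) * X j :
        Fin l → MvPolynomial (Fin m) F) = ArithCircuit.SkewSubst.psi c b := by
  funext i
  simp [ArithCircuit.SkewSubst.psi, MvPolynomial.smul_eq_C_mul]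

/-- `L_ws(g(y)) ≤ (4 L_ws(g) + l)(2m+3)` for affine forms `y` with scalar coefficients
(BLMW 2011 Prop. 9.3.2 proof, through skew circuits). [folklore] -/
private theorem wsComplexity_aeval_affine_le' {l m : ℕ} (g : MvPolynomial (Fin l) F)
    (c : Fin l → F) (b : Fin l → Fin m → F) :
    wsComplexity (aeval (fun i => MvPolynomial.C (c i) +
        ∑ j : Fin m, MvPolynomial.C (b i j) * X j) g) ≤ (4 * wsComplexity g + l) * (2 * m + 3) := by
  classical
  rw [affine_eq_psi]
  refine (wsComplexity_aeval_affine_le c b g).trans ?_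
  rw [Fintype.card_fin, Fintype.card_fin]
  exact Nat.mul_le_mul_right _ (Nat.add_le_add_right (ArithCircuit.skewComplexity_le_four_mul_wsComplexity g) _)

end Affine

/-! ### The one-parameter-family argument -/

section Limit

/-- **Core lemma.** If `f = lim_{t→0} g(y(t))` then `coeffVec f` lies in the Zariski closure of the
coefficient vectors of all `g(y(u))`, `u ∈ ℂˣ`; hence in the closure of any class containing them.
[folklore] -/
private theorem coeffVec_mem_zariskiClosure_of_isLimit {l m : ℕ} (g : MvPolynomial (Fin l) ℂ)
    (f : MvPolynomial (Fin m) ℂ) (a : Fin l → Option (Fin m) → ℂ[T;T⁻¹])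
    (h : IsLimit f (degenerate g a)) (S : Set (MvPolynomial (Fin m) ℂ))
    (hS : ∀ u : ℂˣ, MvPolynomial.map (LaurentPolynomial.eval₂ (RingHom.id ℂ) u) (degenerate g a) ∈ S) :
    coeffVec f ∈ zariskiClosure (coeffVec '' S) := by
  classical
  rw [mem_zariskiClosure_iff]
  intro P hP
  choose p hp using fun μ : Fin m →₀ ℕ =>
    exists_toLaurent_eq_of_coeff_neg (coeff μ (degenerate g a)) (h μ).1
  -- Step 1: `P` vanishes at the coefficient vector of every `g(y(u))`, i.e. at `(p_μ(u))_μ`.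
  have hB : ∀ u : ℂˣ, aeval (fun μ => (p μ).eval (u : ℂ)) P = 0 := by
    intro u
    have hmem := hP _ ⟨_, hS u, rfl⟩
    have hcoe : coeffVec (MvPolynomial.map (LaurentPolynomial.eval₂ (RingHom.id ℂ) u)
        (degenerate g a)) = fun μ => (p μ).eval (u : ℂ) := by
      funext μ
      show MvPolynomial.coeff μ (MvPolynomial.map _ _) = _
      rw [MvPolynomial.coeff_map, ← hp μ, eval₂_toLaurent]
      rfl
    rwa [hcoe] at hmem
  -- Step 2: the polynomial `R = P((p_μ)_μ) ∈ ℂ[t]` vanishes on `ℂˣ`, hence is zero.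
  have hR : aeval p P = (0 : ℂ[X]) := by
    apply Polynomial.eq_zero_of_infinite_isRoot
    refine ((Set.finite_singleton (0 : ℂ)).infinite_compl).mono ?_
    intro x hx
    have hx' : x ≠ 0 := fun h0 => hx (by simp [h0])
    show Polynomial.IsRoot _ x
    rw [Polynomial.IsRoot.def, ← Polynomial.coe_aeval_eq_eval, ← AlgHom.comp_apply,
      MvPolynomial.comp_aeval]
    have := hB (Units.mk0 x hx')
    simpa [Polynomial.coe_aeval_eq_eval] using this
  -- Step 3: evaluate at `t = 0`.
  have h0 := congrArg (Polynomial.eval 0) hR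
  rw [Polynomial.eval_zero, ← Polynomial.coe_aeval_eq_eval, ← AlgHom.comp_apply,
    MvPolynomial.comp_aeval] at h0
  have hfun : (fun μ => Polynomial.aeval (0 : ℂ) (p μ)) = coeffVec f := by
    funext μ
    show Polynomial.aeval (0 : ℂ) (p μ) = coeff μ f
    rw [← (h μ).2, ← hp μ, coeff_toLaurent_zero, Polynomial.coe_aeval_eq_eval]
  rwa [hfun] at h0

/-- **`\underline{L}(f) ≤ L(g) + l(2m+1)`** for a limit `f = lim_{t→0} g(y₁(t),…,y_l(t))` of an
affine Laurent substitution in `m` variables. [cite: GrochowMulmuleyQiao2016, Prop. 3.5 (proof)] -/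
theorem approxComplexity_le_of_isLimit {l m : ℕ} (g : MvPolynomial (Fin l) ℂ)
    (f : MvPolynomial (Fin m) ℂ) (a : Fin l → Option (Fin m) → ℂ[T;T⁻¹])
    (h : IsLimit f (degenerate g a)) : approxComplexity f ≤ complexity g + l * (2 * m + 1) := by
  classical
  refine Nat.sInf_le ?_
  refine coeffVec_mem_zariskiClosure_of_isLimit g f a h _ fun u => ?_
  show complexity _ ≤ _
  rw [map_degenerate_eq _ (fun r => LaurentPolynomial.eval₂_C _ _ r) g a]
  exact complexity_aeval_affine_le g _ _

/-- **`\underline{L_ws}(f) ≤ (4 L_ws(g) + l)(2m+3)`** for a limit `f = lim_{t→0} g(y(t))` of an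
affine Laurent substitution in `m` variables. [cite: GrochowMulmuleyQiao2016, §1.1 (VP_ws analogue of Prop. 3.5)] -/
theorem approxWsComplexity_le_of_isLimit {l m : ℕ} (g : MvPolynomial (Fin l) ℂ)
    (f : MvPolynomial (Fin m) ℂ) (a : Fin l → Option (Fin m) → ℂ[T;T⁻¹])
    (h : IsLimit f (degenerate g a)) :
    approxWsComplexity f ≤ (4 * wsComplexity g + l) * (2 * m + 3) := by
  classical
  refine Nat.sInf_le ?_
  refine coeffVec_mem_zariskiClosure_of_isLimit g f a h _ fun u => ?_
  show wsComplexity _ ≤ _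
  rw [map_degenerate_eq _ (fun r => LaurentPolynomial.eval₂_C _ _ r) g a]
  exact wsComplexity_aeval_affine_le' g _ _

end Limit

/-! ### Prop. 3.5 and its weakly-skew analogue -/

/-- **GMQ16 Prop. 3.5: `VP* ⊆ \overline{VP}`** (tree rendering: `IsVPStarFamily f → IsVPBarFamily f`,
the latter BLMW's Zariski `\overline{VP}`). Only `IsLimit` is used — p-definability and the degree
bound of the degeneration play no role, as in the source. [cite: GrochowMulmuleyQiao2016, Prop. 3.5] -/
theorem prop_3_5_holds : prop_3_5 := by
  rintro v f ⟨l, g, hg, hl, hv, K, s, -, -, hdeg⟩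
  have hb : IsPBounded fun n => complexity (g n) + l n * (2 * v n + 1) :=
    IsPBounded.add_holds hg.2 (IsPBounded.mul_holds hl
      (IsPBounded.add_holds (IsPBounded.mul_holds (IsPBounded.const 2) hv) (IsPBounded.const 1)))
  refine IsPBounded.mono hb fun n => ?_
  obtain ⟨a, -, -, hlim⟩ := hdeg n
  exact approxComplexity_le_of_isLimit (g n) (f n) a hlim

/-- **`VP_ws* ⊆ \overline{VP_ws}`** — the weakly-skew analogue of Prop. 3.5 (the source's "analogue
of VP* for VP_ws", §1.1), in the tree's renderings `GMQ2016.IsVPwsStarFamily` / BLMW's Zariski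
`IsVPwsBarFamily`. [cite: GrochowMulmuleyQiao2016, §1.1 and Prop. 3.5] -/
theorem isVPwsBarFamily_of_isVPwsStarFamily (v : ℕ → ℕ) (f : ∀ n, MvPolynomial (Fin (v n)) ℂ)
    (hf : IsVPwsStarFamily f) : IsVPwsBarFamily f := by
  obtain ⟨l, g, hg, hl, hv, K, s, -, -, hdeg⟩ := hf
  have hb : IsPBounded fun n => (4 * wsComplexity (g n) + l n) * (2 * v n + 3) :=
    IsPBounded.mul_holds (IsPBounded.add_holds (IsPBounded.mul_holds (IsPBounded.const 4) hg) hl)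
      (IsPBounded.add_holds (IsPBounded.mul_holds (IsPBounded.const 2) hv) (IsPBounded.const 3))
  refine IsPBounded.mono hb fun n => ?_
  obtain ⟨a, -, -, hlim⟩ := hdeg n
  exact approxWsComplexity_le_of_isLimit (g n) (f n) a hlim

end Literature.Computability.AlgebraicComplexity.GMQ2016
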